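import Summits.CriticalPhenomena.SAWScalingLimit.Theorems.SAWLoopFugacityFlowIsingBoundaryRatioWindowRectSetting
import Summits.CriticalPhenomena.SAWScalingLimit.Theorems.SAWLoopFugacityFlowIsingBoundaryRatioWindowRectEdgeSet
import Summits.CriticalPhenomena.SAWScalingLimit.Theorems.SAWLoopFugacityFlowIsingBoundaryRatioWindowRectHoleRadius
import Summits.CriticalPhenomena.SAWScalingLimit.Theorems.SAWLoopFugacityFlowIsingBoundaryRatioWindowRectSucc
import HarnessLib

/-!
# The window edge set: construction and first properties
(line `fk-anchor-transfer`, crux `IsingBoundaryRatio`, stmt-CriticalPhenomena-10650; helper file of the stub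
`windowRectPresentation_holds : WindowRectPresentation`)

In the static setting `X : WSetting` (`…WindowRectSetting`): `X.Wset` is the set of sites of `Ω_δ` of chart
radius in `[w₁, w₂]`; `X.S` is the set of sites joined to the base site `z₀` through `Ω_δ`-edges between sites
of `Wset` (the window component of the bulk); `X.E₀` is the set of `Ω_δ`-edges between sites of `S` (induced
and connected); `X.E ⊇ E₀` is the hole-filled edge set of `…WindowRectEdgeSet.exists_filled_edgeSet`. We
record: the specification of `E` (edges of `Ω_δ`, induced on its vertices, connected, combinatorially hole-free,
boundary vertices in `S`, vertices in `S` or at corners of hole faces of `E₀`), and the chart facts of its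
vertices (mesh point in `D` and in `Ω_δ`, chart radius in `[w₁ - κ, w₂ + κ]` by the maximum principle of
`…WindowRectHoleRadius`, membership in the volume and in the ball `B(a, ε)`), whence the fields `mem_edgeSet`,
`mem_window` and `closed` of `IsWindowRect`. [folklore]
-/

noncomputable section

open scoped Classical Topology Real
open Filter Set Metric Complex
open Literature.Probability.LatticeModels Literature.Probability.RandomPlanarGeometry
open Literature.Probability.LatticeModels.DiscreteRect Literature.Probability.LatticeModels.Mesh
open UpperHalfPlane (upperHalfPlaneSet)

namespace Summit.CriticalPhenomena.SAWScalingLimit.Theorems.IsingBoundaryRatio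

namespace WindowRect

namespace WSetting

variable (X : WSetting)

/-! ### The window sites and the window component -/

/-- **The window sites**: sites of `Ω_δ` of chart radius in `[w₁, w₂]`. [folklore] -/
def Wset : Set (Site 2) := {x | x ∈ meshDomain X.D.carrier X.δ ∧ X.w₁ ≤ X.rad x ∧ X.rad x ≤ X.w₂}

/-- **The window component of the bulk**: sites joined to the base site through `Ω_δ`-edges between window
sites. [folklore] -/
def S : Set (Site 2) := {x | Relation.ReflTransGen (fun a b : Site 2 =>
  (discreteDomainGraph X.D.carrier X.δ).Adj a b ∧ a ∈ X.Wset ∧ b ∈ X.Wset) X.z₀ x}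

/-- Membership in `Wset`, unfolded. [folklore] -/
theorem mem_Wset_iff {x : Site 2} : x ∈ X.Wset ↔ x ∈ meshDomain X.D.carrier X.δ ∧ X.w₁ ≤ X.rad x ∧ X.rad x ≤ X.w₂ :=
  Iff.rfl

/-- Membership in `S`, unfolded. [folklore] -/
theorem mem_S_iff {x : Site 2} : x ∈ X.S ↔ Relation.ReflTransGen (fun a b : Site 2 =>
    (discreteDomainGraph X.D.carrier X.δ).Adj a b ∧ a ∈ X.Wset ∧ b ∈ X.Wset) X.z₀ x := Iff.rfl

/-- The chart radius of the base site is within `κ` of `r⋆`. [folklore] -/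
theorem abs_rad_z₀_sub_le : |X.rad X.z₀ - X.rstar| ≤ X.κ := by
  have h := X.hz₀c
  have hn : ‖(((X.r₁' + X.r₂') / 2 : ℝ) : ℂ) * I‖ = X.rstar := by
    rw [norm_mul, norm_I, mul_one, norm_real, Real.norm_eq_abs, rstar_def, abs_of_pos]
    linarith [X.radii.1, X.radii.2.1, X.radii.2.2.1, X.radii.2.2.2.1, X.hm]
  rw [rad_def, ← hn]
  exact (abs_norm_sub_norm_le _ _).trans (by rwa [← dist_eq_norm])

/-- The base site is a window site. [folklore] -/
theorem z₀_mem_Wset : X.z₀ ∈ X.Wset := by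
  have h := abs_le.1 X.abs_rad_z₀_sub_le
  obtain ⟨-, -, h3, h4, h5, -⟩ := X.radii
  have := X.κ_le
  refine ⟨X.hz₀, ?_, ?_⟩ <;> rw [rstar_def] at h <;> linarith [h.1, h.2]

/-- The base site is in `S`. [folklore] -/
theorem z₀_mem_S : X.z₀ ∈ X.S := Relation.ReflTransGen.refl

/-- `S ⊆ Wset`. [folklore] -/
theorem S_subset_Wset : X.S ⊆ X.Wset := by
  intro x hx
  induction hx with
  | refl => exact X.z₀_mem_Wset
  | tail _ h _ => exact h.2.2

/-- Sites of `S` are vertices of `Ω_δ`. [folklore] -/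
theorem mem_meshDomain_of_mem_S {x : Site 2} (hx : x ∈ X.S) : x ∈ meshDomain X.D.carrier X.δ :=
  (X.S_subset_Wset hx).1

/-- **`S` is closed under `Ω_δ`-neighbours in the window.** [folklore] -/
theorem mem_S_of_adj {x y : Site 2} (hx : x ∈ X.S) (hxy : (discreteDomainGraph X.D.carrier X.δ).Adj x y)
    (hy : y ∈ X.Wset) : y ∈ X.S :=
  Relation.ReflTransGen.tail hx ⟨hxy, X.S_subset_Wset hx, hy⟩

/-- `S` is finite. [folklore] -/
theorem S_finite : X.S.Finite :=
  (meshDomain_finite X.D.isBounded X.hδ).subset fun _ hx => X.mem_meshDomain_of_mem_S hx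

/-! ### The induced edge set `E₀` -/

/-- **The edges of `Ω_δ` between sites of `S`.** [folklore] -/
def E₀ : Finset (Sym2 (Site 2)) :=
  ((X.S_finite.toFinset ×ˢ X.S_finite.toFinset).filter fun p =>
    (discreteDomainGraph X.D.carrier X.δ).Adj p.1 p.2).image fun p => s(p.1, p.2)

/-- Membership in `E₀`. [folklore] -/
theorem mem_E₀_iff {e : Sym2 (Site 2)} : e ∈ X.E₀ ↔ ∃ x y, x ∈ X.S ∧ y ∈ X.S ∧
    (discreteDomainGraph X.D.carrier X.δ).Adj x y ∧ e = s(x, y) := by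
  simp only [E₀, Finset.mem_image, Finset.mem_filter, Finset.mem_product, Set.Finite.mem_toFinset, Prod.exists]
  constructor
  · rintro ⟨x, y, ⟨⟨hx, hy⟩, hxy⟩, rfl⟩; exact ⟨x, y, hx, hy, hxy, rfl⟩
  · rintro ⟨x, y, hx, hy, hxy, rfl⟩; exact ⟨x, y, ⟨⟨hx, hy⟩, hxy⟩, rfl⟩

/-- An `Ω_δ`-edge between sites of `S` is in `E₀`. [folklore] -/
theorem mem_E₀ {x y : Site 2} (hx : x ∈ X.S) (hy : y ∈ X.S) (hxy : (discreteDomainGraph X.D.carrier X.δ).Adj x y) :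
    s(x, y) ∈ X.E₀ := X.mem_E₀_iff.2 ⟨x, y, hx, hy, hxy, rfl⟩

/-- The edges of `E₀` are edges of `Ω_δ`. [folklore] -/
theorem E₀_subset_edgeSet : ∀ e ∈ X.E₀, e ∈ (discreteDomainGraph X.D.carrier X.δ).edgeSet := by
  intro e he
  obtain ⟨x, y, -, -, hxy, rfl⟩ := X.mem_E₀_iff.1 he
  exact hxy

/-- A vertex of an edge set is an endpoint of one of its edges. [folklore] -/
theorem exists_of_mem_verts {E : Finset (Sym2 (Site 2))} {x : Site 2} (hx : x ∈ verts E) : ∃ e ∈ E, x ∈ e := by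
  obtain ⟨e, he, hxe⟩ := Finset.mem_biUnion.1 hx
  refine ⟨e, he, ?_⟩
  induction e using Sym2.ind with
  | h a b =>
    simp only [endpts, Sym2.lift_mk, Finset.mem_insert, Finset.mem_singleton] at hxe
    rcases hxe with rfl | rfl
    · exact Sym2.mem_mk_left _ _
    · exact Sym2.mem_mk_right _ _

/-- The vertices of `E₀` are in `S`. [folklore] -/
theorem verts_E₀_subset : ∀ x ∈ verts X.E₀, x ∈ X.S := by
  intro x hx
  obtain ⟨e, he, hxe⟩ := exists_of_mem_verts hx
  obtain ⟨a, b, ha, hb, -, rfl⟩ := X.mem_E₀_iff.1 he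
  rcases Sym2.mem_iff.1 hxe with rfl | rfl
  · exact ha
  · exact hb

/-- `E₀` is induced on its vertices. [folklore] -/
theorem E₀_induced : ∀ x ∈ verts X.E₀, ∀ y ∈ verts X.E₀, (discreteDomainGraph X.D.carrier X.δ).Adj x y →
    s(x, y) ∈ X.E₀ :=
  fun x hx y hy hxy => X.mem_E₀ (X.verts_E₀_subset x hx) (X.verts_E₀_subset y hy) hxy

/-- Every site of `S` is joined to the base site through edges of `E₀`. [folklore] -/
theorem reflTransGen_E₀_of_mem_S {x : Site 2} (hx : x ∈ X.S) :
    Relation.ReflTransGen (fun a b : Site 2 => s(a, b) ∈ X.E₀) X.z₀ x := by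
  induction hx with
  | refl => exact Relation.ReflTransGen.refl
  | @tail b c hb hbc ih => exact ih.tail (X.mem_E₀ hb (Relation.ReflTransGen.tail hb hbc) hbc.1)

/-- Chains of edges of a set of unordered pairs can be reversed. [folklore] -/
theorem reflTransGen_symm {E : Finset (Sym2 (Site 2))} {x y : Site 2}
    (h : Relation.ReflTransGen (fun a b : Site 2 => s(a, b) ∈ E) x y) :
    Relation.ReflTransGen (fun a b : Site 2 => s(a, b) ∈ E) y x := by
  induction h with
  | refl => exact Relation.ReflTransGen.refl
  | tail _ hbc ih => exact Relation.ReflTransGen.head (by rw [Sym2.eq_swap]; exact hbc) ih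

/-- `E₀` is connected. [folklore] -/
theorem E₀_connected : ∀ x ∈ verts X.E₀, ∀ y ∈ verts X.E₀,
    Relation.ReflTransGen (fun a b : Site 2 => s(a, b) ∈ X.E₀) x y :=
  fun x hx y hy => (reflTransGen_symm (X.reflTransGen_E₀_of_mem_S (X.verts_E₀_subset x hx))).trans
    (X.reflTransGen_E₀_of_mem_S (X.verts_E₀_subset y hy))

/-! ### The filled edge set `E` -/

/-- **The window edge set**: the hole-filling of `E₀` (`…WindowRectEdgeSet.exists_filled_edgeSet`). [folklore] -/
def E : Finset (Sym2 (Site 2)) :=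
  Classical.choose (exists_filled_edgeSet X.D.toJordanDomain X.hδ X.E₀_subset_edgeSet X.E₀_induced X.E₀_connected)

/-- The specification of `E`. [folklore] -/
theorem E_spec : X.E₀ ⊆ X.E ∧
    (∀ e ∈ X.E, e ∈ (discreteDomainGraph X.D.carrier X.δ).edgeSet) ∧
    (∀ x ∈ verts X.E, ∀ y ∈ verts X.E, (discreteDomainGraph X.D.carrier X.δ).Adj x y → s(x, y) ∈ X.E) ∧
    (∀ x ∈ verts X.E, ∀ y ∈ verts X.E, Relation.ReflTransGen (fun a b : Site 2 => s(a, b) ∈ X.E) x y) ∧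
    (∀ g : Site 2, (∃ j : Fin 4, s(corner g j, corner g j + dir j) ∉ X.E) → ∀ M : ℤ, ∃ g' : Site 2,
      M ≤ g' 1 ∧ Relation.ReflTransGen
        (fun a b : Site 2 => ∃ j : Fin 4, b = a + dir (j + 3) ∧ s(corner a j, corner a j + dir j) ∉ X.E) g g') ∧
    (∀ x ∈ bdVerts X.E, x ∈ verts X.E₀) ∧
    (∀ x ∈ verts X.E, x ∈ verts X.E₀ ∨ ∃ h : Site 2, IsCorner x h ∧
      ¬ ∀ M : ℤ, ∃ g' : Site 2, M ≤ g' 1 ∧ Relation.ReflTransGen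
        (fun a b : Site 2 => ∃ k : Fin 4, b = a + cornerUnit k ∧
          s(a + cornerOff (k + 1), a + cornerOff (k + 2)) ∉ X.E₀) h g') :=
  Classical.choose_spec (exists_filled_edgeSet X.D.toJordanDomain X.hδ X.E₀_subset_edgeSet X.E₀_induced X.E₀_connected)

/-- `E₀ ⊆ E`. [folklore] -/
theorem E₀_subset_E : X.E₀ ⊆ X.E := X.E_spec.1

/-- The edges of `E` are edges of `Ω_δ`. [folklore] -/
theorem E_subset_edgeSet : ∀ e ∈ X.E, e ∈ (discreteDomainGraph X.D.carrier X.δ).edgeSet := X.E_spec.2.1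

/-- The edges of `E` are lattice edges. [folklore] -/
theorem E_subset_zd : ∀ e ∈ X.E, e ∈ (zdGraph 2).edgeSet := by
  intro e he
  have h := X.E_subset_edgeSet e he
  induction e using Sym2.ind with
  | h a b =>
    rw [SimpleGraph.mem_edgeSet] at h ⊢
    exact ((meshGraph_adj_iff.1 (discreteDomainGraph_adj_iff.1 h).1).1)

/-- `E` is induced on its vertices. [folklore] -/
theorem E_induced {x y : Site 2} (hx : x ∈ verts X.E) (hy : y ∈ verts X.E)
    (hxy : (discreteDomainGraph X.D.carrier X.δ).Adj x y) : s(x, y) ∈ X.E := X.E_spec.2.2.1 x hx y hy hxy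

/-- `E` is connected. [folklore] -/
theorem E_connected : ∀ x ∈ verts X.E, ∀ y ∈ verts X.E,
    Relation.ReflTransGen (fun a b : Site 2 => s(a, b) ∈ X.E) x y := X.E_spec.2.2.2.1

/-- `E` is combinatorially hole-free. [folklore] -/
theorem E_escape : ∀ g : Site 2, (∃ j : Fin 4, s(corner g j, corner g j + dir j) ∉ X.E) → ∀ M : ℤ, ∃ g' : Site 2,
    M ≤ g' 1 ∧ Relation.ReflTransGen
      (fun a b : Site 2 => ∃ j : Fin 4, b = a + dir (j + 3) ∧ s(corner a j, corner a j + dir j) ∉ X.E) g g' :=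
  X.E_spec.2.2.2.2.1

/-- **Boundary vertices of `E` are in `S`.** [folklore] -/
theorem mem_S_of_mem_bdVerts {x : Site 2} (hx : x ∈ bdVerts X.E) : x ∈ X.S :=
  X.verts_E₀_subset x (X.E_spec.2.2.2.2.2.1 x hx)

/-- The base of an external dart of `E` is in `S`. [folklore] -/
theorem mem_S_of_isExtDart {d : Site 2 × Fin 4} (hd : IsExtDart X.E d) : d.1 ∈ X.S :=
  X.mem_S_of_mem_bdVerts ⟨d.2, by rw [Prod.mk.eta]; exact hd⟩

/-- Sites of `S` with at least one... : a site of `S` with an `S`-neighbour is a vertex of `E`. [folklore] -/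
theorem mem_verts_E_of_mem_S {x y : Site 2} (hx : x ∈ X.S) (hy : y ∈ X.S)
    (hxy : (discreteDomainGraph X.D.carrier X.δ).Adj x y) : x ∈ verts X.E :=
  mem_verts_of_mem_left (X.E₀_subset_E (X.mem_E₀ hx hy hxy))

/-! ### Chart facts of the vertices of `E` -/

/-- **A vertex of `E` is a vertex of `Ω_δ` with chart radius in `[w₁ - κ, w₂ + κ]`.** [folklore] -/
theorem vertex_facts {x : Site 2} (hx : x ∈ verts X.E) :
    x ∈ meshDomain X.D.carrier X.δ ∧ X.w₁ - X.κ ≤ X.rad x ∧ X.rad x ≤ X.w₂ + X.κ := by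
  rcases X.E_spec.2.2.2.2.2.2 x hx with h | ⟨h, hxh, hh⟩
  · obtain ⟨hxD, h1, h2⟩ := X.S_subset_Wset (X.verts_E₀_subset x h)
    exact ⟨hxD, by linarith [X.hκ], by linarith [X.hκ]⟩
  · -- a corner of a hole face of `E₀`: maximum principle
    have hS : ∀ a b : Site 2, (fun a b : Site 2 => ∃ k : Fin 4, b = a + cornerUnit k ∧
        s(a + cornerOff (k + 1), a + cornerOff (k + 2)) ∉ X.E₀) a b ↔
        ∃ k : Fin 4, b = a + cornerUnit k ∧ s(a + cornerOff (k + 1), a + cornerOff (k + 2)) ∉ X.E₀ :=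
      fun _ _ => Iff.rfl
    have hxD := corner_mem_meshDomain_hole X.D.toJordanDomain X.hδ X.E₀_subset_edgeSet hS hh hxh
    refine ⟨hxD, ?_⟩
    -- the chart `g` and the bounds along the edges of `E₀`
    have hgd : DifferentiableOn ℂ X.g X.D.carrier := X.φ.symm.differentiableOn_coe.congr X.hg_eq
    have hg0 : ∀ z ∈ X.D.carrier, X.g z ≠ 0 := by
      intro z hz h0
      have := X.im_pos hz
      rw [← X.g_eq hz, h0, Complex.zero_im] at this
      exact lt_irrefl _ this
    have hlo : 0 < X.w₁ - X.κ := by linarith [X.radii.1, X.w₁_def, X.κ_le.1, X.hm]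
    have hbd : ∀ a b : Site 2, s(a, b) ∈ X.E₀ → ∀ z ∈ segment ℝ (meshPoint X.δ a) (meshPoint X.δ b),
        z ≠ X.D.pt 1 ∧ X.w₁ - X.κ ≤ ‖X.g z‖ ∧ ‖X.g z‖ ≤ X.w₂ + X.κ := by
      intro a b hab z hz
      obtain ⟨a', b', ha', -, hadj, he⟩ := X.mem_E₀_iff.1 hab
      -- `z` is within `δ` of the endpoint `a'` (a site of `S`)
      have haz : z ∈ segment ℝ (meshPoint X.δ a') (meshPoint X.δ b') := by
        rcases Sym2.eq_iff.1 he with ⟨rfl, rfl⟩ | ⟨rfl, rfl⟩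
        · exact hz
        · rw [segment_symm]; exact hz
      obtain ⟨hmesh, ha'D, -⟩ := discreteDomainGraph_adj_iff.1 hadj
      obtain ⟨hzd, hseg⟩ := meshGraph_adj_iff.1 hmesh
      have hzcl : z ∈ closure X.D.carrier := hseg haz
      have hpa : meshPoint X.δ a' ∈ X.D.carrier := X.meshPoint_mem ha'D
      obtain ⟨-, h1, h2⟩ := X.S_subset_Wset ha'
      have hra : X.rad a' ≤ X.r₂ + X.m := by linarith [X.radii.2.2.2.2.2, X.hm]
      have hdz : dist (meshPoint X.δ a') z ≤ X.δ := by
        have hb := (convex_closedBall (meshPoint X.δ a') X.δ).segment_subset (mem_closedBall_self X.hδ.le)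
          (by rw [mem_closedBall, dist_comm, X.dist_meshPoint_adj hzd]) haz
        rw [mem_closedBall, dist_comm] at hb; exact hb
      have hosc := X.osc hpa hra hzcl (by linarith [X.hδ])
      have hzb : z ≠ X.D.pt 1 := by
        intro hzb
        have := X.far hpa hra
        rw [← hzb] at this
        linarith [X.hδd, X.hδ]
      rw [rad_def] at h1 h2
      have hn := abs_norm_sub_norm_le (X.g z) (X.φ.symm (meshPoint X.δ a'))
      rw [← dist_eq_norm] at hn
      have hn' := abs_le.1 (hn.trans hosc)
      exact ⟨hzb, by linarith [hn'.1], by linarith [hn'.2]⟩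
    have h := norm_chart_corner_hole X.D.toJordanDomain X.hδ X.E₀_subset_edgeSet hS hlo X.hg_cont hgd
      X.pt_one_not_mem hg0 hbd hh hxh
    rw [rad_def, ← X.g_eq (X.meshPoint_mem hxD)]
    exact h

/-- A vertex of `E` has its mesh point in `D`. [folklore] -/
theorem meshPoint_mem_of_mem_verts {x : Site 2} (hx : x ∈ verts X.E) : meshPoint X.δ x ∈ X.D.carrier :=
  X.meshPoint_mem (X.vertex_facts hx).1

/-- A vertex of `E` is in the volume `Λ`. [folklore] -/
theorem mem_Λ_of_mem_verts {x : Site 2} (hx : x ∈ verts X.E) : x ∈ X.Λ := by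
  obtain ⟨hxD, -, h2⟩ := X.vertex_facts hx
  exact X.mem_Λ hxD (by linarith [X.w₂_def, X.κ_le.1, X.hm])

/-- **A vertex of `E` is a window site of the finite volume.** [folklore] -/
theorem mem_annWindow_of_mem_verts {x : Site 2} (hx : x ∈ verts X.E) :
    (⟨x, X.mem_Λ_of_mem_verts hx⟩ : ↥X.Λ) ∈ annWindow X.D X.φ X.M X.ε X.δ X.ρ X.r₁ X.r₂ X.Λ := by
  obtain ⟨hxD, h1, h2⟩ := X.vertex_facts hx
  obtain ⟨-, h0, -, -, -, h5⟩ := X.radii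
  have := X.κ_le; have := X.hm; have := X.hρr₁; have := X.hr₂
  have hr : X.rad x ≤ X.r₂ := by rw [w₂_def] at h2; linarith
  refine ⟨⟨X.mem_ball (X.meshPoint_mem hxD) hr, ?_, ?_⟩, ?_, ?_⟩ <;>
    simp only [← rad_def] <;> rw [w₁_def] at h1 <;> rw [w₂_def] at h2 <;> linarith

/-! ### Three fields of `IsWindowRect` -/

/-- **`mem_window`.** [folklore] -/
theorem mem_window : ∀ e ∈ X.E, ∀ x ∈ e, ∃ hx : x ∈ X.Λ,
    (⟨x, hx⟩ : ↥X.Λ) ∈ annWindow X.D X.φ X.M X.ε X.δ X.ρ X.r₁ X.r₂ X.Λ := by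
  intro e he x hxe
  have hx : x ∈ verts X.E := by
    induction e using Sym2.ind with
    | h a b =>
      rcases Sym2.mem_iff.1 hxe with rfl | rfl
      · exact mem_verts_of_mem_left he
      · exact mem_verts_of_mem he
  exact ⟨X.mem_Λ_of_mem_verts hx, X.mem_annWindow_of_mem_verts hx⟩

/-- **`closed`** (in the strong form: every `Ω_δ`-neighbour in the window of a vertex of `E` of chart radius in
`[w₁ + κ, w₂ - κ]` is joined to it in `E`). [folklore] -/
theorem closed' {x y : Site 2} (hx : x ∈ verts X.E) (h1 : X.w₁ + X.κ ≤ X.rad x) (h2 : X.rad x ≤ X.w₂ - X.κ)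
    (hxy : (discreteDomainGraph X.D.carrier X.δ).Adj x y) : s(x, y) ∈ X.E := by
  by_cases hxS : x ∈ bdVerts X.E
  · -- `x ∈ S`, and `y` is a window site: `y ∈ S`
    have hxS' := X.mem_S_of_mem_bdVerts hxS
    obtain ⟨-, -, hyD⟩ := discreteDomainGraph_adj_iff.1 hxy
    have hzd := (meshGraph_adj_iff.1 (discreteDomainGraph_adj_iff.1 hxy).1).1
    have hrad := X.abs_rad_sub_rad_le (X.meshPoint_mem_of_mem_verts hx) (X.meshPoint_mem hyD) hzd
      (by linarith [X.radii.2.2.2.2.2, X.hm, X.hκ])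
    rw [abs_le] at hrad
    have hyW : y ∈ X.Wset := ⟨hyD, by linarith [hrad.1], by linarith [hrad.2]⟩
    exact X.E₀_subset_E (X.mem_E₀ hxS' (X.mem_S_of_adj hxS' hxy hyW) hxy)
  · -- `x` is not a boundary vertex: every lattice edge at `x` is in `E`
    by_contra h
    have hzd := (meshGraph_adj_iff.1 (discreteDomainGraph_adj_iff.1 hxy).1).1
    obtain ⟨k, rfl⟩ := exists_eq_add_dir_of_adj hzd
    exact hxS ⟨k, hx, h⟩

/-- **`closed`** in the form of `IsWindowRect`. [folklore] -/
theorem closed : ∀ (x y : Site 2) (hy : y ∈ X.Λ), x ∈ verts X.E →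
    X.r₁' ≤ ‖X.φ.symm (meshPoint X.δ x)‖ → ‖X.φ.symm (meshPoint X.δ x)‖ ≤ X.r₂' →
    (discreteDomainGraph X.D.carrier X.δ).Adj x y →
    (⟨y, hy⟩ : ↥X.Λ) ∈ annWindow X.D X.φ X.M X.ε X.δ X.ρ X.r₁ X.r₂ X.Λ → s(x, y) ∈ X.E := by
  intro x y _ hx h1 h2 hxy _
  have := X.radii; have := X.κ_le; have := X.hm
  exact X.closed' hx (by rw [rad_def]; linarith) (by rw [rad_def]; linarith) hxy

end WSetting

end WindowRect

/-- **The window edge set is closed along the inner window**, closed form (registered sub-goal of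
stmt-CriticalPhenomena-10650). [folklore] -/
theorem windowRect_closed : ∀ (X : WindowRect.WSetting) (x y : Site 2) (hy : y ∈ X.Λ), x ∈ DiscreteRect.verts X.E → X.r₁' ≤ ‖X.φ.symm (meshPoint X.δ x)‖ → ‖X.φ.symm (meshPoint X.δ x)‖ ≤ X.r₂' → (discreteDomainGraph X.D.carrier X.δ).Adj x y → (⟨y, hy⟩ : ↥X.Λ) ∈ annWindow X.D X.φ X.M X.ε X.δ X.ρ X.r₁ X.r₂ X.Λ → s(x, y) ∈ X.E :=
  fun X => X.closed

end Summit.CriticalPhenomena.SAWScalingLimit.Theorems.IsingBoundaryRatio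

end
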